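import Literature.MathematicalPhysics.QuantumFieldTheory.Balaban1983to89.T4ActivityLipschitz

/-!
# NE5 ∕ U3, route P2 — the cluster representation `ClusterRep` BUILT from the printed-letters polymer geometry of the
# carriers' localization domains (skeleton `t4/skeletons/NE5-t4-ne5-p2.md` §5 row O1′ R-rep, generic part: what remains
# for Bałaban's step is the carriers instance O1-a and the activity families)

Cell `pub-balaban`, unit `b2b-balaban-t4-ne5-p2-g17` (T⁴ fan-out NE5 ∕ node U3, PROVER seat P2 «polymer-activity Lipschitz route»).
Summits-side new work under the LEAN PLACEMENT RULE (cell modelling + bookkeeping; NOT a Literature module).  HONEST FRAMING: rung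
(B)+1 of the FINITE-VOLUME T⁴ continuum programme — NOT infinite volume, NOT a mass gap, NOT the Clay problem, NOT a proof of NE5
(NOT PRINTED in [Balaban1987RG1]–[Balaban1989LargeFieldII]; they print ε-UNIFORM bounds, never η-RATES).  HONEST DEPENDENCY (cell
line, verbatim): continuum YM on T⁴ ⇐ BetaPertH ∧ nine spine estimates (0/9 proved); BetaPertH ⇐ (D1) ∧ (D4) ∧ CAP+tail; G-an2-4
gates asym, D1 and NE2/3/4.

WHAT THIS FILE DOES.  The activity route's END faces are stated over a `T4ActivityLipschitz.ClusterRep C` (leaf L01's carrier: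
polymers, incompatibility, step volumes `vol X`, the families `clus X` localizing at `X`, a pin, two activity families).  For
localization domains with FOOTPRINTS this structure is printed-letters combinatorics ([Balaban1988RG2Cluster] (2.11)–(2.13) p. 14:
*"ζ(Z, Z′) = 0 if Z ∩ Z′ contains a cube, or a wall of a cube"*, *"E^{(k+1)}(X) = Σ … Σ_{(Z_1,…,Z_n): ∪Z_i = X} ρ^T(Z_1,…,Z_n)
H(Z_1)…H(Z_n), (2.13) where X ∈ 𝐃_{k+1}"* — the tree's `B13FamilySum.coveringFamilies` ∕ `B13Resummation.locE` typing).  We build it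
ONCE AND FOR ALL from a `DomainGeometry` of the carriers (DATA: footprints `cubes : C.Dom → Finset Cube`, the finite catalogues
`level k` = 𝐃_k, a symmetric touching relation on footprints containing footprint-overlap, nonempty footprints) and the two
activity families:
* `DomainGeometry.clusterRep G ρA ρB : ClusterRep C` — polymers = the domains themselves, `inc X Y` = same scale ∧ footprints
  touch, `vol X = level (scale X)`, `clus X = coveringFamilies (level (scale X)) cubes (cubes X)` (families of scale-`X` domains
  whose footprints cover `X` exactly), `pin X = X`; the five structure obligations (`inc_refl`, `inc_symm`, `clus_sub`, `pin_mem`,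
  `clus_pin` — every covering family touches `X`) are PROVED (finite combinatorics);
* `outB_eq`∕`outA_eq`: the represented outputs ARE the (2.13)-shaped sums `Σ_{K covers X} Φ^T(K; ρ g U)`;
* `represents_re`: `Represents` (L01) holds BY DEFINITION for the functionals `EBre`∕`EAre` defined as the real parts of these
  sums (run A under the reading `ActTransported`: its activity family at `U` depends on `U` only through `C.transport U`).
So O1′ R-rep for Bałaban's step = «instantiate `DomainGeometry b13Carriers`» once the owner's O1-a carriers exist (footprints and
𝐃_k are its fields), and the activity families come from O1′ R-terms through `InputModel.Realizes`; L01 carries no inequality.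
Nothing of the manuscripts under audit is asserted (cited for KIND∕locus only).  0 sorry; no new axioms.
-/

namespace Summit.QuantumFields.BalabanUV.T4Continuum.ClusterRepOfDomains

open Literature.Probability.LatticeModels (KPTouches truncatedWeight)
open Literature.MathematicalPhysics.QuantumFieldTheory.Balaban1983to89.T4OutputRate (Carriers Functional)
open Literature.MathematicalPhysics.QuantumFieldTheory.Balaban1983to89.T4ActivityLipschitz (ClusterRep clusterSum)
open Literature.MathematicalPhysics.QuantumFieldTheory.Balaban1983to89.B13FamilySum (coveringFamilies)

/-- [folklore] DATA (no inequality inside): the printed-letters polymer geometry of the carriers' localization domains —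
footprints, the finite catalogues 𝐃_k, a touching relation on footprints (ζ = 0 of (2.11)) which is symmetric and contains
footprint-overlap, nonempty footprints. -/
structure DomainGeometry (C : Carriers) [DecidableEq C.Dom] (Cube : Type*) [DecidableEq Cube] where
  /-- footprint of a domain (its cubes) -/
  cubes : C.Dom → Finset Cube
  /-- the finite catalogue 𝐃_k of domains created at step `k` -/
  level : ℕ → Finset C.Dom
  mem_level : ∀ (Y : C.Dom) (k : ℕ), Y ∈ level k ↔ C.scale Y = k
  /-- ζ(F, G) = 0: the footprints touch -/
  touch : Finset Cube → Finset Cube → Prop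
  [decTouch : DecidableRel touch]
  touch_symm : ∀ F G, touch F G → touch G F
  touch_of_inter : ∀ F G, (F ∩ G).Nonempty → touch F G
  cubes_nonempty : ∀ Y, (cubes Y).Nonempty

namespace DomainGeometry

variable {C : Carriers} [DecidableEq C.Dom] {Cube : Type*} [DecidableEq Cube] (G : DomainGeometry C Cube)

/-- [folklore] The touching relation is decidable (field `decTouch`). -/
instance instDecTouch : DecidableRel G.touch := G.decTouch

/-- [folklore] The incompatibility of two domains: same creation step and touching footprints. -/
def inc (X Y : C.Dom) : Prop := C.scale X = C.scale Y ∧ G.touch (G.cubes X) (G.cubes Y)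

/-- [folklore] The incompatibility is decidable. -/
instance instDecRelInc : DecidableRel G.inc := fun _ _ => instDecidableAnd

/-- [folklore] Reflexivity (a nonempty footprint overlaps itself). -/
theorem inc_refl (X : C.Dom) : G.inc X X :=
  ⟨rfl, G.touch_of_inter _ _ (by rw [Finset.inter_self]; exact G.cubes_nonempty X)⟩

/-- [folklore] Symmetry. -/
theorem inc_symm (X Y : C.Dom) (h : G.inc X Y) : G.inc Y X := ⟨h.1.symm, G.touch_symm _ _ h.2⟩

/-- [folklore] The families of scale-`X` domains whose footprints cover `X` exactly ((2.13)'s index set). -/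
def clus (X : C.Dom) : Finset (Finset C.Dom) := coveringFamilies (G.level (C.scale X)) G.cubes (G.cubes X)

/-- [folklore] Membership in `clus X`. -/
theorem mem_clus {X : C.Dom} {K : Finset C.Dom} :
    K ∈ G.clus X ↔ K ⊆ G.level (C.scale X) ∧ K.biUnion G.cubes = G.cubes X := by
  simp [clus, coveringFamilies, Finset.mem_filter, Finset.mem_powerset]

/-- [folklore] A covering family lies in the step volume. -/
theorem clus_sub (X : C.Dom) (K : Finset C.Dom) (hK : K ∈ G.clus X) : K ⊆ G.level (C.scale X) := (G.mem_clus.1 hK).1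

/-- [folklore] `X` is in its own step volume. -/
theorem self_mem_level (X : C.Dom) : X ∈ G.level (C.scale X) := (G.mem_level X _).2 rfl

/-- [folklore] Every family covering `X` touches `X` (some member shares a cube with `X`). -/
theorem clus_pin (X : C.Dom) (K : Finset C.Dom) (hK : K ∈ G.clus X) : KPTouches G.inc K X := by
  obtain ⟨hKsub, hcover⟩ := G.mem_clus.1 hK
  obtain ⟨c, hc⟩ := G.cubes_nonempty X
  have hc' : c ∈ K.biUnion G.cubes := by rw [hcover]; exact hc
  obtain ⟨Z, hZK, hcZ⟩ := Finset.mem_biUnion.1 hc'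
  refine ⟨Z, hZK, ?_, G.touch_of_inter _ _ ⟨c, Finset.mem_inter.2 ⟨hcZ, hc⟩⟩⟩
  exact (G.mem_level Z _).1 (hKsub hZK)

/-- [folklore] **THE CLUSTER REPRESENTATION OF THE CARRIERS' DOMAIN GEOMETRY** with activity families `ρA`, `ρB`
(polymers = domains; every structure obligation proved). -/
def clusterRep (ρA ρB : (ℕ → ℝ) → C.BgB → C.Dom → ℂ) : ClusterRep C where
  P := C.Dom
  inc := G.inc
  inc_refl := G.inc_refl
  inc_symm := G.inc_symm
  vol X := G.level (C.scale X)
  clus := G.clus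
  clus_sub := G.clus_sub
  pin X := X
  pin_mem := G.self_mem_level
  clus_pin := G.clus_pin
  ρA := ρA
  ρB := ρB

variable (ρA ρB : (ℕ → ℝ) → C.BgB → C.Dom → ℂ)

/-- [folklore] Run B's represented output at `X` IS the (2.13)-shaped sum of truncated weights over the families covering `X`. -/
theorem outB_eq (g : ℕ → ℝ) (U : C.BgB) (X : C.Dom) :
    (G.clusterRep ρA ρB).outB g U X = ∑ K ∈ G.clus X, truncatedWeight G.inc (ρB g U) K := rfl

/-- [folklore] Run A's represented output likewise (its activities already at the transported background). -/
theorem outA_eq (g : ℕ → ℝ) (U : C.BgB) (X : C.Dom) :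
    (G.clusterRep ρA ρB).outA g U X = ∑ K ∈ G.clus X, truncatedWeight G.inc (ρA g U) K := rfl

/-- [folklore] Run B's functional DEFINED as the real part of its represented output. -/
noncomputable def EBre : Functional C C.BgB := fun g U X => ((G.clusterRep ρA ρB).outB g U X).re

/-- [folklore] HYPOTHESIS SHAPE (a READING, how the carriers pair the runs; no estimate): run A's activity family at the run-B
background `U` depends on `U` only through the transported background `C.transport U`. -/
def ActTransported : Prop := ∀ (g : ℕ → ℝ) (U U' : C.BgB), C.transport U = C.transport U' → ρA g U = ρA g U'

open Classical in
/-- [folklore] Run A's functional DEFINED as the real part of its represented output at any preimage of the transported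
background (`0` off the image of the transport — never read). -/
noncomputable def EAre : Functional C C.BgA := fun g V X =>
  if h : ∃ U : C.BgB, C.transport U = V then ((G.clusterRep ρA ρB).outA g (Classical.choose h) X).re else 0

variable {ρA ρB}

/-- [folklore] Under the reading, `EAre` at a transported background is the represented output there. -/
theorem EAre_transport (hA : ActTransported ρA) (g : ℕ → ℝ) (U : C.BgB) (X : C.Dom) :
    G.EAre ρA ρB g (C.transport U) X = ((G.clusterRep ρA ρB).outA g U X).re := by
  have h : ∃ U' : C.BgB, C.transport U' = C.transport U := ⟨U, rfl⟩
  unfold EAre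
  rw [dif_pos h, outA_eq, outA_eq, hA g _ _ (Classical.choose_spec h)]

/-- [folklore] **L01 BY DEFINITION**: `Represents` holds for the functionals defined as the real parts of the represented
outputs (run A under the transported reading). -/
theorem represents_re (hA : ActTransported ρA) : (G.clusterRep ρA ρB).Represents (G.EAre ρA ρB) (G.EBre ρA ρB) :=
  ⟨fun g U X => G.EAre_transport hA g U X, fun _ _ _ => rfl⟩

end DomainGeometry

end Summit.QuantumFields.BalabanUV.T4Continuum.ClusterRepOfDomains
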